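import Summits.Langlands.Langlands.Theses.TowerDoorSplit

/-!
# Route TowerDoorSplit — Assembly

The assembly item (stmt-Langlands-27000) of the child route `TowerDoorSplit` (decomp-langlands lens-5 gen 19; V-R refining child
`--refines route-Langlands-EllipticDegreeLadder:HighDegreeEllipticAutomorphy`, 91st cell route, second thaw slot 2026-08-31) for
HIGH = `EllipticDegreeLadder.HighDegreeEllipticAutomorphy` (stmt-Langlands-31034):
`AbelianOrCyclotomicWitnessAutomorphy → FifteenStableCoverWitnessAutomorphy → TwentyOneStableCoverWitnessAutomorphy →
UnanchoredHighDegreeWitnessAutomorphy → Summit.Langlands.Langlands.Theses.EllipticDegreeLadder.HighDegreeEllipticAutomorphy`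
(three nested case splits on the witness tower of the high-degree box).

This is literally the type of the route file's sorry-free deciding theorem `Summit.Langlands.Langlands.Theses.TowerDoorSplit.closes`.
Nothing here proves `Langlands` (nor HIGH): the assembly records only that the four cells of the route, taken together, imply the parent piece
by name.
-/

set_option linter.dupNamespace false -- project-wide option (lakefile weak.linter.dupNamespace); `Summit.Langlands.Langlands` is the mandated namespace

namespace Summit.Langlands.Langlands.Theorems

/-- **Assembly of route TowerDoorSplit** (stmt-Langlands-27000):
`AbelianOrCyclotomicWitnessAutomorphy → FifteenStableCoverWitnessAutomorphy → TwentyOneStableCoverWitnessAutomorphy →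
UnanchoredHighDegreeWitnessAutomorphy → Summit.Langlands.Langlands.Theses.EllipticDegreeLadder.HighDegreeEllipticAutomorphy`.
Proof: unfold `Assembly` and apply the route's deciding theorem `Theses.TowerDoorSplit.closes`. -/
theorem towerDoorSplit_assembly_proof :
    Summit.Langlands.Langlands.Theses.TowerDoorSplit.Assembly := by
  unfold Summit.Langlands.Langlands.Theses.TowerDoorSplit.Assembly
  exact Summit.Langlands.Langlands.Theses.TowerDoorSplit.closes

end Summit.Langlands.Langlands.Theorems
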